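import Literature.AlgebraicGeometry.Motives.AbelianVarietyWeilPairingAlternating
import Literature.Algebra.Module.DivisibleTorsionIdealImage
import HarnessLib

/-!
# Isotropy of the level Weil pairing between ideal-torsion subgroups: `ē^Θ_N(A[𝔟], A[𝔠]) = 1` when `𝔠·𝔟̄ = (N)` and `𝔟̄` is `ē`-adjoint to `𝔟`
# ([MumfordAV1970] §20 (1)–(3), §23 p. 208 and Thm. 2 p. 231; [Shimura1998] (18.4b); [AtiyahMacdonald1969] Prop. 1.10, Cor. 9.4)

Layer `Literature/AlgebraicGeometry/Motives`, namespace `Literature.AlgebraicGeometry.Motives.AbelianVariety`.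
THEOREMS ONLY (no definition, no named fact, no instance, no `sorry`).  Cell `hodgecm-mathlib` (D-0151), P6 «MOD» (crux hLiu418 =
stmt-HodgeConjecture-24832, `--supports`, count-neutral): line L3 ROOF road «DUAL-B̄» (LA3-plan RULING #3), the **ISOTROPY ORGAN
«`ē^Θ_n(A[𝔟](κ̄), A[n𝔟̄⁻¹](κ̄)) = 1`»** of the non-Lagrangian quotient-dual engine (`K := A[𝔟]`, `K′ := λ_*A[𝔠]`, `𝔠 := n𝔟̄⁻¹`) — the
abelian-VARIETY head, composed of ★ (DEC) `Algebra/Module/DivisibleTorsionIdealImage` and the (ADJ) adjunction hypothesis (supplied at a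
geometric point of a CM family by ★ `AbelianSchemes/WeilDivisorPullbackOfRosatiAtPoint.weilPairingLevel_map_fibreHom_eq_of_rosati` from the
Rosati row `ι(ā) ≫ λ = λ ≫ ι(a)^∨`).  HC_CM is proved only modulo the printed citations until rung 0 closes; nothing here is about HC.

THE MATHEMATICS.  Let `X` be an abelian variety over a field `K`, `Θ` a Cartier divisor, `N` a level with `[N]` dominant, and
`φ : 𝒪 → (X(K) → X(K))` an additive, multiplicative, unital family of endomorphisms of the group `X(K)` over a Dedekind domain `𝒪`, every
`φ(r)`, `r ≠ 0`, surjective and `φ(N) = (·)^N` (the `K`-points of a ring action `ι : 𝒪 → End X` by isogenies over `K` algebraically closed).  Let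
`𝔟`, `𝔟̄`, `𝔠` be ideals with `𝔟̄ ≠ 0`, **`𝔠·𝔟̄ = (N)`**, and suppose every nonzero `j ∈ 𝔟̄` has an **`ē^Θ_N`-ADJOINT `b ∈ 𝔟`**:
`ē^Θ_N(φ(b)P, Q) = ē^Θ_N(P, φ(j)Q)` on `X[N]` (for a CM action, `j = b̄` and this is the Rosati adjunction [MumfordAV1970] §23 p. 208 /
[Shimura1998] (18.4b)).  THEN for `x ∈ X[N]` killed by `𝔟` and `y ∈ X[N]` killed by `𝔠`:

  **`ē^Θ_N(x, y) = 1`.**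

Proof: by (DEC) (★ `exists_mem_forall_torsion_exists_apply_eq_of_mul_eq_span`) there is ONE `j ∈ 𝔟̄` with `X[𝔠] = φ(j)·X[(N)]`, so `y = φ(j)z` with
`z^N = 1`; if `j = 0` then `y = 1`; otherwise take the adjoint `b ∈ 𝔟` of `j`: `ē(x, y) = ē(x, φ(j)z) = ē(φ(b)x, z) = ē(1, z) = 1`
(★ `weilPairingLevel_one_left`).  This is the isotropy half of [MumfordAV1970] §23 Thm. 2 (descent of a polarisation through an isogeny with
`e^λ`-isotropic kernel) for the pair of kernels `(A[𝔟], A[n𝔟̄⁻¹])`, with NO freeness, counting or perfectness input.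

* `weilPairingLevel_eq_one_of_idealTorsion` (THE HEAD, `x ∈ X[𝔟]`, `y ∈ X[𝔠]`); `weilPairingLevel_eq_one_of_idealTorsion_swap` (`x ∈ X[𝔠]`,
  `y ∈ X[𝔟]`, via skew-symmetry ★ `weilPairingLevel_swap` — needs `N`-th roots of `x`, `y` in `X(K)`, automatic from the surjectivity of `φ(N)`).

## References
* [MumfordAV1970] D. Mumford, *Abelian Varieties* (1970), §20 pp. 183–186 (properties (1)–(3) of `e_n`), §23 p. 208 and Thm. 2 (p. 231).
* [Shimura1998] G. Shimura, *Abelian Varieties with Complex Multiplication and Modular Functions* (1998), (18.4b) p. 126.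
* [AtiyahMacdonald1969] M. F. Atiyah, I. G. Macdonald, *Introduction to Commutative Algebra* (1969), Prop. 1.10 (p. 7), Cor. 9.4 (p. 95).
-/

universe u

open CategoryTheory CategoryTheory.Limits AlgebraicGeometry MonoidalCategory CartesianMonoidalCategory

noncomputable section

namespace Literature.AlgebraicGeometry.Motives

open scoped MonObj
open Literature.Algebra.Module.DivisibleTorsionIdealImage

namespace AbelianVariety

variable {K : Type u} [Field K] {X : AbelianVariety K} {O : Type*} [CommRing O] [IsDedekindDomain O]
  (φ : O → X.Points K → X.Points K) (hmul : ∀ r x y, φ r (x * y) = φ r x * φ r y)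
  (hadd : ∀ r s x, φ (r + s) x = φ r x * φ s x) (hcomp : ∀ r s x, φ (r * s) x = φ r (φ s x)) (hone : ∀ x, φ 1 x = x)
  (hsurj : ∀ r : O, r ≠ 0 → Function.Surjective (φ r))
  {N : ℕ} [IsDominant (Hom.toSchemeHom ((N : ℤ) • 𝟙 X))] (hN : ∀ x : X.Points K, φ (N : O) x = x ^ N)

include hmul hadd hcomp hone hsurj hN in
/-- **ISOTROPY OF `ē^Θ_N` BETWEEN `X[𝔟]` AND `X[𝔠]` FOR `𝔠·𝔟̄ = (N)`.**  `X` an abelian variety over `K`, `φ : 𝒪 → End X(K)` an additive,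
multiplicative, unital family over a Dedekind domain with all `φ(r)` (`r ≠ 0`) surjective and `φ(N) = (·)^N`; ideals `𝔟`, `𝔟̄ ≠ 0`, `𝔠` with
`𝔠·𝔟̄ = (N)`; every nonzero `j ∈ 𝔟̄` has an `ē^Θ_N`-adjoint `b ∈ 𝔟` (`ē(φ(b)P, Q) = ē(P, φ(j)Q)` on `X[N]` — the Rosati adjunction for a CM action).
Then `ē^Θ_N(x, y) = 1` for all `x, y ∈ X[N]` with `φ(𝔟)x = 1`, `φ(𝔠)y = 1`.  (`y = φ(j)z` for ONE `j ∈ 𝔟̄` and `z ∈ X[N]` by ★ (DEC); then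
`ē(x, φ(j)z) = ē(φ(b)x, z) = ē(1, z) = 1`.) [cite: MumfordAV1970, §23 (p. 208) and Thm. 2 (p. 231)] [cite: Shimura1998, (18.4b) (p. 126)]
[cite: AtiyahMacdonald1969, Prop. 1.10 (p. 7) and Cor. 9.4 (p. 95)] -/
theorem weilPairingLevel_eq_one_of_idealTorsion {𝔟 𝔟' 𝔠 : Ideal O} (h𝔟'0 : 𝔟' ≠ ⊥) (h𝔠 : 𝔠 * 𝔟' = Ideal.span {(N : O)})
    (Θ : CartierDivisor X.X.left)
    (hadj : ∀ j ∈ 𝔟', j ≠ 0 → ∃ b ∈ 𝔟, ∀ P Q P' Q' : X.torsionPoints K N,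
      (P' : X.Points K) = φ b P → (Q' : X.Points K) = φ j Q → X.weilPairingLevel Θ P' Q = X.weilPairingLevel Θ P Q')
    (x y : X.torsionPoints K N) (hx : ∀ b ∈ 𝔟, φ b x = 1) (hy : ∀ r ∈ 𝔠, φ r y = 1) :
    X.weilPairingLevel Θ x y = 1 := by
  -- (DEC): one `j ∈ 𝔟̄` with `X[𝔠] = φ(j)·X[(N)]`
  obtain ⟨j, hj𝔟', hj⟩ :=
    exists_mem_forall_torsion_exists_apply_eq_of_mul_eq_span φ hmul hadd hcomp hone hsurj (I := 𝔠) h𝔟'0 h𝔠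
  obtain ⟨z, hzN, hzy⟩ := hj y hy
  have hz : z ∈ X.torsionPoints K N := by
    rw [mem_torsionPoints_iff, zpow_natCast, ← hN, hzN]
  by_cases hj0 : j = 0
  · -- `y = φ(0) z = 1`
    have hy1 : y = 1 := Subtype.ext (by rw [← hzy, hj0, map_zero_apply φ hadd]; rfl)
    rw [hy1, weilPairingLevel_one_right]
  · obtain ⟨b, hb𝔟, hb⟩ := hadj j hj𝔟' hj0
    have h1 : ((1 : X.torsionPoints K N) : X.Points K) = φ b x := by
      rw [hx b hb𝔟]
      rfl
    rw [← hb x ⟨z, hz⟩ 1 y h1 hzy.symm, weilPairingLevel_one_left]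

include hmul hadd hcomp hone hsurj hN in
/-- **The swapped isotropy `ē^Θ_N(x, y) = 1` for `φ(𝔠)x = 1`, `φ(𝔟)y = 1`** (skew-symmetry ★ `weilPairingLevel_swap`; the `N`-th roots it asks for
exist because `φ(N) = (·)^N` is surjective, `N ≠ 0` in `𝒪`). [cite: MumfordAV1970, §20 (p. 186, e_n skew-symmetric) and §23 Thm. 2 (p. 231)]
[cite: Lang1983AbelianVarieties, Ch. VII §2 Thm. 5 (i)] -/
theorem weilPairingLevel_eq_one_of_idealTorsion_swap {𝔟 𝔟' 𝔠 : Ideal O} (h𝔟'0 : 𝔟' ≠ ⊥) (h𝔠 : 𝔠 * 𝔟' = Ideal.span {(N : O)})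
    (hN0 : (N : O) ≠ 0) (Θ : CartierDivisor X.X.left)
    (hadj : ∀ j ∈ 𝔟', j ≠ 0 → ∃ b ∈ 𝔟, ∀ P Q P' Q' : X.torsionPoints K N,
      (P' : X.Points K) = φ b P → (Q' : X.Points K) = φ j Q → X.weilPairingLevel Θ P' Q = X.weilPairingLevel Θ P Q')
    (x y : X.torsionPoints K N) (hx : ∀ r ∈ 𝔠, φ r x = 1) (hy : ∀ b ∈ 𝔟, φ b y = 1) :
    X.weilPairingLevel Θ x y = 1 := by
  have hroot : ∀ P : X.torsionPoints K N, ∃ R : X.Points K, R ^ N = P.1 := fun P => by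
    obtain ⟨R, hR⟩ := hsurj (N : O) hN0 P.1
    exact ⟨R, by rw [← hN, hR]⟩
  rw [weilPairingLevel_swap Θ y x (hroot y) (hroot x),
    weilPairingLevel_eq_one_of_idealTorsion φ hmul hadd hcomp hone hsurj hN h𝔟'0 h𝔠 Θ hadj y x hy hx, inv_one]

end AbelianVariety

end Literature.AlgebraicGeometry.Motives

end
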